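import Summits.QuantumFields.YangMills.Theorems.BalabanUVNodesN08HaarCompatibilityGuardCoreWindowLipschitzSUN
import Literature.Analysis.Calculus.ContDiffCodRestrict

/-!
# BalabanUVNodes ∕ N08 — THE CHART CONJUGATE OF THE PRINTED exp-mean-log CORE MAP AT A GUARDED CENTRE OF `SU(N)`, EVERY `N`:
# semiconjugacy, `MapsTo` the chart ball, injectivity, differentiability within the window, and the Haar-Jacobian floor `(1 − Σcᵢ)^{N²−1}`

WIDTH SEAT `pub-ymgap-dag-n08-w6` g5, item-3 lineage, 2026-08-28 (INTENT-2, part B of the 400-line split).  DAG node N08 = [Balaban1985UV3] Thm 1 p. 257 (compact) +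
Thm 2 p. 272; the typed (0.4) averaging and its guard = [Balaban1987RG1] (0.4) p. 253; key item K1⁷ `StabilityBAtRecordR13SepCoPH` (stmt-QuantumFields-20542),
`--supports … --as helper`.  COUNT-NEUTRAL.

THE POINT.  For `Φ : SU(N) → SU(N)` agreeing with `Kmat V c` on an open set `O` of guarded points (`‖Vᵢw* − 1‖ < deltaSU`), a centre `W₀ ∈ O`, the window
`Ω = {X : ‖X‖ < r, W₀·Θ X ∈ O}` of the chart algebra and the CHART CONJUGATE `ψ X = Λ(Φ(W₀)⁻¹·Φ(W₀·Θ X))` (`Θ`, `Λ` = lit-balaban's exponential ∕ logarithmic chart of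
`SU(N)`), with radii `r ≤ 1∕2`, `‖e^Z − 1‖ < 1∕6` on `‖Z‖ < r`, `2B·r ≤ r_C`, `4B·r ≤ s`, `r ≤ r₉` (all independent of `V`, `W₀`, `O`, `Φ`):
 `isOpen_windowSet` · `coe_conj_eq` (`↑(Φ(W₀)⁻¹Φ(W₀ΘX)) = (Kmat W₀)*·Kmat(W₀e^X)`) · `norm_conj_sub_one_le` (`≤ 2B‖X‖`, part A's Lipschitz modulus) · ★ `semiconj`
 (`Φ(W₀)⁻¹·Φ(W₀·Θ X) = Θ(ψ X)`) · ★ `norm_conj_chart_lt` (`MapsTo` the `s`-ball) · ★ `injOn_conj` (p626433 `uniform_injectivity_windows` read through `Θ`) ·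
 `hasFDerivAt_ambient` · ★★ `hasFDerivAt_coe_conj` ∕ `differentiableAt_conj` (chain rule in `M_N(ℂ)` — INTENT-1 `hasFDerivAt_coe_exp`, pub-balaban
 `hasStrictFDerivAt_Kmat`, `analyticAt_mlog` — then `Literature.Analysis.Calculus.ContDiffCodRestrict` into the CLOSED subspace `𝔰𝔲(N)`) · ★★★ **`jacobian_ge` — THE
 FLOOR `(1 − Σcᵢ)^{N²−1} ≤ J_Ψ(Θ X)` on `Ω`** (INTENT-1 `jacobian_eq_abs_det_leftTangent`: `J = |det T|`, with the ambient expression `M ↦ (Kmat W₀)*·Kmat(W₀·M)`, its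
 derivative `(Kmat W₀)*·emlD(W₀e^X)·(W₀·)`, and part A's pinch at `W = W₀e^X`).  These are EXACTLY the per-window hypotheses of INTENT-1's frame
`haar_map_le_of_windows_id`; the sequel `…GuardCoreLawSUN` picks the radii, covers `SU(N)` and assembles (H_K-core) ∕ (H_K) ∕ part 20's bound for every `N`.

HONEST FRAMING.  [folklore] matrix calculus ∕ bookkeeping BY IMPORT; nothing of Bałaban's asserted; (H_K) ∕ (H_K-core) NOT discharged in this file; E6′ NOT decided; `hmass` NOT
supplied; count-neutral; N08 NOT discharged; counts unmoved (typed 28∕28 · discharged 5∕27); one finite 𝕋⁴ programme at fixed ε — R4 closes the CONDITIONAL rung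
`BalabanLadder.UV` only; the Yang–Mills mass gap (Clay) is NOT proved; nothing continuum ∕ OS.  0 `sorry`, 0 `def`, 0 `instance`, 0 `notation`, standard axioms.
-/

noncomputable section

open NormedSpace Set Function Filter Topology MeasureTheory
open scoped ENNReal NNReal Matrix Matrix.Norms.L2Operator

namespace Summit.QuantumFields.YangMills.BalabanUVNodes.N08HaarCompatibilityGuardCoreChartConjugateSUN

open Literature.MathematicalPhysics.QuantumFieldTheory.Balaban1983to89
open Literature.MathematicalPhysics.QuantumFieldTheory.Balaban1983to89.HaarExponentialChart
open Literature.MathematicalPhysics.QuantumFieldTheory.Balaban1983to89.HaarExponentialChart.IsChartRep (chartRadius innerRadius)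
open Literature.MathematicalPhysics.QuantumFieldTheory.Balaban1983to89.B13HaarSigmaJacobian (jac adg adg_apply_coe)
open Literature.MathematicalPhysics.QuantumFieldTheory.Balaban1983to89.T4EMLTangentInjective (Kmat emlD hasStrictFDerivAt_Kmat)
open Literature.MathematicalPhysics.QuantumFieldTheory.Balaban1983to89.T4AdjointCovarianceUnitary (lieSU mem_lieSU_iff)
open Literature.MathematicalPhysics.QuantumFieldTheory.Balaban1983to89.ExpMeanLog (deltaSU lt_third_of_lt_deltaSU)
open Literature.MathematicalPhysics.QuantumFieldTheory.Balaban1983to89.MatrixLog (mlog)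
open Literature.Analysis.Calculus.ExpDifferential (gSer norm_gSer_sub_one_le exp_neg_mul_exp_eq_one)
open Literature.MathematicalPhysics.QuantumLattice (fundamentalRep fundamentalRep_apply)
open Summit.QuantumFields.YangMills.BalabanUVNodes.N08HaarCompatibilityGuardIntrinsicJacobian
open Summit.QuantumFields.YangMills.BalabanUVNodes.N08HaarCompatibilityGuardInjectivityWindows (uniform_injectivity_windows exists_bound_emlD exists_norm_exp_sub_one_lt)
open Summit.QuantumFields.YangMills.BalabanUVNodes.N08HaarCompatibilityGuardJacobianDet (kmat_mem_unitaryGroup)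
open Summit.QuantumFields.YangMills.BalabanUVNodes.N08HaarCompatibilityGuardJacobianDetSU (exists_leftTangent_lieSU guard_half_of_deltaSU)
open Summit.QuantumFields.YangMills.BalabanUVNodes.N08HaarCompatibilityGuardJacobianContractionDet (abs_det_leftTangentSU_pinch_specialUnitary)

variable {N : ℕ} [NeZero N] {ι : Type*} [Fintype ι]

open Summit.QuantumFields.YangMills.BalabanUVNodes.N08HaarCompatibilityGuardCoreWindowLipschitzSUN

/-! ## §3 The chart conjugate of the core map at a guarded centre -/

section Conjugate

variable (V : ι → Matrix.specialUnitaryGroup (Fin N) ℂ) (c : ι → ℝ) (W₀ : Matrix.specialUnitaryGroup (Fin N) ℂ)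
  (Φ : Matrix.specialUnitaryGroup (Fin N) ℂ → Matrix.specialUnitaryGroup (Fin N) ℂ) (O : Set (Matrix.specialUnitaryGroup (Fin N) ℂ))
  (hO : ∀ w ∈ O, ∀ i, ‖(V i : Matrix (Fin N) (Fin N) ℂ) * star (w : Matrix (Fin N) (Fin N) ℂ) - 1‖ < deltaSU (Fin N))
  (hΦ : ∀ w ∈ O, ((Φ w : Matrix.specialUnitaryGroup (Fin N) ℂ) : Matrix (Fin N) (Fin N) ℂ) =
    Kmat (fun i => (V i : Matrix (Fin N) (Fin N) ℂ)) c (w : Matrix (Fin N) (Fin N) ℂ))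
  (hW₀ : W₀ ∈ O)

/-- **THE WINDOW SET IS OPEN**: `{X | ‖X‖ < r ∧ W₀·Θ X ∈ O}` is open for open `O`. [folklore] -/
theorem isOpen_windowSet (hOo : IsOpen O) (r : ℝ) :
    IsOpen {X : (specialUnitaryLogChart (Fin N)).lie | ‖X‖ < r ∧ W₀ * (isChartRep_specialUnitaryGroup (n := Fin N)).expChart X ∈ O} :=
  (isOpen_lt continuous_norm continuous_const).inter
    (hOo.preimage ((continuous_const.mul (isChartRep_specialUnitaryGroup (n := Fin N)).continuous_expChart)))

include hΦ hW₀ in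
/-- **THE CONJUGATE IN MATRICES**: `↑(Φ(W₀)⁻¹·Φ(W₀·Θ X)) = (Kmat W₀)*·Kmat(W₀e^X)` when `W₀·Θ X ∈ O`. [folklore] -/
theorem coe_conj_eq {X : (specialUnitaryLogChart (Fin N)).lie} (hX : W₀ * (isChartRep_specialUnitaryGroup (n := Fin N)).expChart X ∈ O) :
    (((Φ W₀)⁻¹ * Φ (W₀ * (isChartRep_specialUnitaryGroup (n := Fin N)).expChart X) : Matrix.specialUnitaryGroup (Fin N) ℂ) : Matrix (Fin N) (Fin N) ℂ) =
      star (Kmat (fun i => (V i : Matrix (Fin N) (Fin N) ℂ)) c (W₀ : Matrix (Fin N) (Fin N) ℂ)) *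
        Kmat (fun i => (V i : Matrix (Fin N) (Fin N) ℂ)) c ((W₀ : Matrix (Fin N) (Fin N) ℂ) * exp (X : Matrix (Fin N) (Fin N) ℂ)) := by
  rw [Submonoid.coe_mul, coe_inv_eq_star, hΦ W₀ hW₀, hΦ _ hX, coe_mul_expChart]

include hO hΦ hW₀ in
/-- **ITS DISTANCE TO `1`**: `‖(Kmat W₀)*·Kmat(W₀e^X) − 1‖ = ‖Kmat(W₀e^X) − Kmat(W₀)‖` (unitary isometry), hence `≤ 2B·‖X‖` under §2's hypotheses. [folklore] -/
theorem norm_conj_sub_one_le {B : ℝ} (hB0 : 0 < B)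
    (hB : ∀ (h : ι → Matrix (Fin N) (Fin N) ℂ) (W : Matrix (Fin N) (Fin N) ℂ), (∀ i, h i ∈ Matrix.unitaryGroup (Fin N) ℂ) →
      W ∈ Matrix.unitaryGroup (Fin N) ℂ → (∀ i, ‖h i * star W - 1‖ ≤ 1 / 2) → ‖emlD h c W‖ ≤ B)
    {r : ℝ} (hr2 : r ≤ 1 / 2) (hre : ∀ Z : Matrix (Fin N) (Fin N) ℂ, ‖Z‖ < r → ‖exp Z - 1‖ < 1 / 6)
    {X : (specialUnitaryLogChart (Fin N)).lie} (hXr : ‖X‖ < r) (hX : W₀ * (isChartRep_specialUnitaryGroup (n := Fin N)).expChart X ∈ O) :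
    ‖(((Φ W₀)⁻¹ * Φ (W₀ * (isChartRep_specialUnitaryGroup (n := Fin N)).expChart X) : Matrix.specialUnitaryGroup (Fin N) ℂ) : Matrix (Fin N) (Fin N) ℂ) - 1‖
      ≤ 2 * B * ‖X‖ := by
  have hVu : ∀ i, (V i : Matrix (Fin N) (Fin N) ℂ) ∈ Matrix.unitaryGroup (Fin N) ℂ := fun i => (Matrix.mem_specialUnitaryGroup_iff.mp (V i).2).1
  have hW₀u : (W₀ : Matrix (Fin N) (Fin N) ℂ) ∈ Matrix.unitaryGroup (Fin N) ℂ := (Matrix.mem_specialUnitaryGroup_iff.mp W₀.2).1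
  have hKu : Kmat (fun i => (V i : Matrix (Fin N) (Fin N) ℂ)) c (W₀ : Matrix (Fin N) (Fin N) ℂ) ∈ Matrix.unitaryGroup (Fin N) ℂ :=
    kmat_mem_unitaryGroup hVu hW₀u (guard_half_of_deltaSU (hO W₀ hW₀)) c
  set U := Kmat (fun i => (V i : Matrix (Fin N) (Fin N) ℂ)) c (W₀ : Matrix (Fin N) (Fin N) ℂ) with hU
  set A := Kmat (fun i => (V i : Matrix (Fin N) (Fin N) ℂ)) c ((W₀ : Matrix (Fin N) (Fin N) ℂ) * exp (X : Matrix (Fin N) (Fin N) ℂ)) with hA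
  rw [coe_conj_eq V c W₀ Φ O hΦ hW₀ hX]
  have e : star U * A - 1 = star U * (A - U) := by
    rw [mul_sub, Matrix.mem_unitaryGroup_iff'.mp hKu]
  rw [e, CStarRing.norm_mem_unitary_mul _ (Unitary.star_mem hKu)]
  exact norm_kmat_expChart_sub_le V c hB0 hB hr2 hre W₀ (hO W₀ hW₀) hXr

include hO hΦ hW₀ in
/-- ★ **THE SEMICONJUGACY** `Φ(W₀)⁻¹·Φ(W₀·Θ X) = Θ(ψ X)`, `ψ X := Λ(Φ(W₀)⁻¹·Φ(W₀·Θ X))`, on the window `‖X‖ < r`, `W₀·Θ X ∈ O`, once `2B·r ≤ r_C` (the conjugate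
stays in the log chart). [cite: Helgason2000, Ch. I §1 Thm. 1.14 (13) p. 96] -/
theorem semiconj {B : ℝ} (hB0 : 0 < B)
    (hB : ∀ (h : ι → Matrix (Fin N) (Fin N) ℂ) (W : Matrix (Fin N) (Fin N) ℂ), (∀ i, h i ∈ Matrix.unitaryGroup (Fin N) ℂ) →
      W ∈ Matrix.unitaryGroup (Fin N) ℂ → (∀ i, ‖h i * star W - 1‖ ≤ 1 / 2) → ‖emlD h c W‖ ≤ B)
    {r : ℝ} (hr2 : r ≤ 1 / 2) (hre : ∀ Z : Matrix (Fin N) (Fin N) ℂ, ‖Z‖ < r → ‖exp Z - 1‖ < 1 / 6)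
    (hrB : 2 * B * r ≤ innerRadius (specialUnitaryLogChart (Fin N)))
    {X : (specialUnitaryLogChart (Fin N)).lie} (hXr : ‖X‖ < r) (hX : W₀ * (isChartRep_specialUnitaryGroup (n := Fin N)).expChart X ∈ O) :
    (Φ W₀)⁻¹ * Φ (W₀ * (isChartRep_specialUnitaryGroup (n := Fin N)).expChart X) =
      (isChartRep_specialUnitaryGroup (n := Fin N)).expChart
        ((isChartRep_specialUnitaryGroup (n := Fin N)).logChart ((Φ W₀)⁻¹ * Φ (W₀ * (isChartRep_specialUnitaryGroup (n := Fin N)).expChart X))) := by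
  have h2B : 2 * B * ‖X‖ < 2 * B * r := mul_lt_mul_of_pos_left hXr (by positivity)
  have hlt : ‖fundamentalRep (Fin N) ((Φ W₀)⁻¹ * Φ (W₀ * (isChartRep_specialUnitaryGroup (n := Fin N)).expChart X)) - 1‖ <
      innerRadius (specialUnitaryLogChart (Fin N)) := by
    rw [fundamentalRep_apply]
    exact lt_of_le_of_lt (norm_conj_sub_one_le V c W₀ Φ O hO hΦ hW₀ hB0 hB hr2 hre hXr hX) (h2B.trans_le hrB)
  exact ((isChartRep_specialUnitaryGroup (n := Fin N)).expChart_logChart hlt).symm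

include hO hΦ hW₀ in
/-- ★ **`MapsTo` THE CHART BALL**: `‖ψ X‖ ≤ 4B·‖X‖ < s` on the window, once `2B·r ≤ r_C` and `4B·r ≤ s` (`‖log P‖ ≤ 2‖P − 1‖`).
[cite: Helgason2000, Ch. I §1 Thm. 1.14 (13) p. 96] -/
theorem norm_conj_chart_lt {B : ℝ} (hB0 : 0 < B)
    (hB : ∀ (h : ι → Matrix (Fin N) (Fin N) ℂ) (W : Matrix (Fin N) (Fin N) ℂ), (∀ i, h i ∈ Matrix.unitaryGroup (Fin N) ℂ) →
      W ∈ Matrix.unitaryGroup (Fin N) ℂ → (∀ i, ‖h i * star W - 1‖ ≤ 1 / 2) → ‖emlD h c W‖ ≤ B)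
    {r : ℝ} (hr2 : r ≤ 1 / 2) (hre : ∀ Z : Matrix (Fin N) (Fin N) ℂ, ‖Z‖ < r → ‖exp Z - 1‖ < 1 / 6)
    (hrB : 2 * B * r ≤ innerRadius (specialUnitaryLogChart (Fin N))) {s : ℝ} (hrs : 4 * B * r ≤ s)
    {X : (specialUnitaryLogChart (Fin N)).lie} (hXr : ‖X‖ < r) (hX : W₀ * (isChartRep_specialUnitaryGroup (n := Fin N)).expChart X ∈ O) :
    ‖(isChartRep_specialUnitaryGroup (n := Fin N)).logChart ((Φ W₀)⁻¹ * Φ (W₀ * (isChartRep_specialUnitaryGroup (n := Fin N)).expChart X))‖ < s := by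
  have hle := norm_conj_sub_one_le V c W₀ Φ O hO hΦ hW₀ hB0 hB hr2 hre hXr hX
  have h2B : 2 * B * ‖X‖ < 2 * B * r := mul_lt_mul_of_pos_left hXr (by positivity)
  have hlt' : ‖(((Φ W₀)⁻¹ * Φ (W₀ * (isChartRep_specialUnitaryGroup (n := Fin N)).expChart X) : Matrix.specialUnitaryGroup (Fin N) ℂ) :
      Matrix (Fin N) (Fin N) ℂ) - 1‖ < innerRadius (specialUnitaryLogChart (Fin N)) := lt_of_le_of_lt hle (h2B.trans_le hrB)
  have hlt : ‖fundamentalRep (Fin N) ((Φ W₀)⁻¹ * Φ (W₀ * (isChartRep_specialUnitaryGroup (n := Fin N)).expChart X)) - 1‖ <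
      innerRadius (specialUnitaryLogChart (Fin N)) := by
    rw [fundamentalRep_apply]; exact hlt'
  rw [← Submodule.norm_coe, (isChartRep_specialUnitaryGroup (n := Fin N)).coe_logChart hlt, fundamentalRep_apply]
  have hhalf : ‖(((Φ W₀)⁻¹ * Φ (W₀ * (isChartRep_specialUnitaryGroup (n := Fin N)).expChart X) : Matrix.specialUnitaryGroup (Fin N) ℂ) :
      Matrix (Fin N) (Fin N) ℂ) - 1‖ ≤ 1 / 2 := (hlt'.trans_le IsChartRep.innerRadius_le_half).le
  calc ‖mlog ((((Φ W₀)⁻¹ * Φ (W₀ * (isChartRep_specialUnitaryGroup (n := Fin N)).expChart X) : Matrix.specialUnitaryGroup (Fin N) ℂ) :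
      Matrix (Fin N) (Fin N) ℂ))‖ ≤ 2 * ‖(((Φ W₀)⁻¹ * Φ (W₀ * (isChartRep_specialUnitaryGroup (n := Fin N)).expChart X) :
        Matrix.specialUnitaryGroup (Fin N) ℂ) : Matrix (Fin N) (Fin N) ℂ) - 1‖ := MatrixLog.norm_mlog_le_two_mul hhalf
    _ ≤ 2 * (2 * B * ‖X‖) := by gcongr
    _ < 2 * (2 * B * r) := by linarith
    _ = 4 * B * r := by ring
    _ ≤ s := hrs

include hO hΦ hW₀ in
/-- ★ **INJECTIVITY ON THE WINDOW** (p626433 `uniform_injectivity_windows` read through `Θ`): if `X ↦ Kmat V c (W₀e^X)` is injective on the skew ball of radius `r₉`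
and `r ≤ r₉`, then `ψ` is injective on `{‖X‖ < r, W₀·Θ X ∈ O}`. [folklore] -/
theorem injOn_conj {B : ℝ} (hB0 : 0 < B)
    (hB : ∀ (h : ι → Matrix (Fin N) (Fin N) ℂ) (W : Matrix (Fin N) (Fin N) ℂ), (∀ i, h i ∈ Matrix.unitaryGroup (Fin N) ℂ) →
      W ∈ Matrix.unitaryGroup (Fin N) ℂ → (∀ i, ‖h i * star W - 1‖ ≤ 1 / 2) → ‖emlD h c W‖ ≤ B)
    {r : ℝ} (hr2 : r ≤ 1 / 2) (hre : ∀ Z : Matrix (Fin N) (Fin N) ℂ, ‖Z‖ < r → ‖exp Z - 1‖ < 1 / 6)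
    (hrB : 2 * B * r ≤ innerRadius (specialUnitaryLogChart (Fin N))) {r₉ : ℝ} (hr : r ≤ r₉)
    (hinj : InjOn (fun X : Matrix (Fin N) (Fin N) ℂ => Kmat (fun i => (V i : Matrix (Fin N) (Fin N) ℂ)) c ((W₀ : Matrix (Fin N) (Fin N) ℂ) * exp X))
      (Metric.ball (0 : Matrix (Fin N) (Fin N) ℂ) r₉ ∩ {X | Xᴴ = -X})) :
    InjOn (fun X : (specialUnitaryLogChart (Fin N)).lie =>
        (isChartRep_specialUnitaryGroup (n := Fin N)).logChart ((Φ W₀)⁻¹ * Φ (W₀ * (isChartRep_specialUnitaryGroup (n := Fin N)).expChart X)))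
      {X : (specialUnitaryLogChart (Fin N)).lie | ‖X‖ < r ∧ W₀ * (isChartRep_specialUnitaryGroup (n := Fin N)).expChart X ∈ O} := by
  intro X hX Y hY hXY
  have hΘ := congrArg (isChartRep_specialUnitaryGroup (n := Fin N)).expChart hXY
  simp only at hΘ
  rw [← semiconj V c W₀ Φ O hO hΦ hW₀ hB0 hB hr2 hre hrB hX.1 hX.2, ← semiconj V c W₀ Φ O hO hΦ hW₀ hB0 hB hr2 hre hrB hY.1 hY.2] at hΘ
  have h2 : Φ (W₀ * (isChartRep_specialUnitaryGroup (n := Fin N)).expChart X) = Φ (W₀ * (isChartRep_specialUnitaryGroup (n := Fin N)).expChart Y) :=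
    mul_left_cancel hΘ
  have h3 : Kmat (fun i => (V i : Matrix (Fin N) (Fin N) ℂ)) c ((W₀ : Matrix (Fin N) (Fin N) ℂ) * exp (X : Matrix (Fin N) (Fin N) ℂ)) =
      Kmat (fun i => (V i : Matrix (Fin N) (Fin N) ℂ)) c ((W₀ : Matrix (Fin N) (Fin N) ℂ) * exp (Y : Matrix (Fin N) (Fin N) ℂ)) := by
    rw [← coe_mul_expChart, ← coe_mul_expChart, ← hΦ _ hX.2, ← hΦ _ hY.2, h2]
  have hmem : ∀ Z : (specialUnitaryLogChart (Fin N)).lie, ‖Z‖ < r →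
      (Z : Matrix (Fin N) (Fin N) ℂ) ∈ Metric.ball (0 : Matrix (Fin N) (Fin N) ℂ) r₉ ∩ {X | Xᴴ = -X} := fun Z hZ =>
    ⟨mem_ball_zero_iff.2 (by rw [Submodule.norm_coe]; exact hZ.trans_le hr),
      by rw [mem_setOf_eq, ← Matrix.star_eq_conjTranspose]; exact (mem_specialUnitaryLogChart_lie.1 Z.2).1⟩
  exact Subtype.ext (hinj (hmem X hX.1) (hmem Y hY.1) h3)

include hO in
/-- **THE AMBIENT EXPRESSION AND ITS DERIVATIVE**: `M ↦ (Kmat W₀)*·Kmat V c (W₀·M)` has Fréchet derivative `(Kmat W₀)*·emlD(W₀e^X)·(W₀·)` at `e^X` whenever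
`W₀·Θ X ∈ O` (pub-balaban's `hasStrictFDerivAt_Kmat` on the guard, composed with two left multiplications). [folklore] -/
theorem hasFDerivAt_ambient {X : (specialUnitaryLogChart (Fin N)).lie} (hX : W₀ * (isChartRep_specialUnitaryGroup (n := Fin N)).expChart X ∈ O) :
    HasFDerivAt (fun M : Matrix (Fin N) (Fin N) ℂ => star (Kmat (fun i => (V i : Matrix (Fin N) (Fin N) ℂ)) c (W₀ : Matrix (Fin N) (Fin N) ℂ)) *
        Kmat (fun i => (V i : Matrix (Fin N) (Fin N) ℂ)) c ((W₀ : Matrix (Fin N) (Fin N) ℂ) * M))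
      ((ContinuousLinearMap.mul ℝ (Matrix (Fin N) (Fin N) ℂ) (star (Kmat (fun i => (V i : Matrix (Fin N) (Fin N) ℂ)) c (W₀ : Matrix (Fin N) (Fin N) ℂ)))).comp
        ((emlD (fun i => (V i : Matrix (Fin N) (Fin N) ℂ)) c ((W₀ : Matrix (Fin N) (Fin N) ℂ) * exp (X : Matrix (Fin N) (Fin N) ℂ))).comp
          (ContinuousLinearMap.mul ℝ (Matrix (Fin N) (Fin N) ℂ) (W₀ : Matrix (Fin N) (Fin N) ℂ)))) (exp (X : Matrix (Fin N) (Fin N) ℂ)) := by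
  have hg1 : ∀ i, ‖(V i : Matrix (Fin N) (Fin N) ℂ) * star ((W₀ : Matrix (Fin N) (Fin N) ℂ) * exp (X : Matrix (Fin N) (Fin N) ℂ)) - 1‖ < 1 := fun i => by
    rw [← coe_mul_expChart]; exact (lt_third_of_lt_deltaSU (hO _ hX i)).trans (by norm_num)
  have hf : HasFDerivAt (fun M : Matrix (Fin N) (Fin N) ℂ => (W₀ : Matrix (Fin N) (Fin N) ℂ) * M)
      (ContinuousLinearMap.mul ℝ (Matrix (Fin N) (Fin N) ℂ) (W₀ : Matrix (Fin N) (Fin N) ℂ)) (exp (X : Matrix (Fin N) (Fin N) ℂ)) :=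
    (ContinuousLinearMap.mul ℝ (Matrix (Fin N) (Fin N) ℂ) (W₀ : Matrix (Fin N) (Fin N) ℂ)).hasFDerivAt
  have hKa := (hasStrictFDerivAt_Kmat (fun i => (V i : Matrix (Fin N) (Fin N) ℂ)) c hg1).hasFDerivAt.comp _ hf
  exact (ContinuousLinearMap.mul ℝ (Matrix (Fin N) (Fin N) ℂ) _).hasFDerivAt.comp _ hKa

include hO hΦ hW₀ in
/-- ★★ **THE CONJUGATE IS DIFFERENTIABLE ON THE WINDOW, IN MATRICES**: for `X` in the window (`O` open, `2B·r ≤ r_C`), the map `Y ↦ ↑(ψ Y)` has a Fréchet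
derivative at `X` (namely `D log(P) ∘ [(Kmat W₀)*·emlD(W₀e^X)·(W₀·)] ∘ [e^X·jac X ·]`, `P = (Kmat W₀)*·Kmat(W₀e^X)`; chain rule: INTENT-1's `hasFDerivAt_coe_exp`,
pub-balaban's `hasStrictFDerivAt_Kmat`, `analyticAt_mlog`; near `X` the conjugate IS `log P(Y)` by `coe_conj_eq` ∕ `coe_logChart`). [folklore] -/
theorem hasFDerivAt_coe_conj (hOo : IsOpen O) {B : ℝ} (hB0 : 0 < B)
    (hB : ∀ (h : ι → Matrix (Fin N) (Fin N) ℂ) (W : Matrix (Fin N) (Fin N) ℂ), (∀ i, h i ∈ Matrix.unitaryGroup (Fin N) ℂ) →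
      W ∈ Matrix.unitaryGroup (Fin N) ℂ → (∀ i, ‖h i * star W - 1‖ ≤ 1 / 2) → ‖emlD h c W‖ ≤ B)
    {r : ℝ} (hr2 : r ≤ 1 / 2) (hre : ∀ Z : Matrix (Fin N) (Fin N) ℂ, ‖Z‖ < r → ‖exp Z - 1‖ < 1 / 6)
    (hrB : 2 * B * r ≤ innerRadius (specialUnitaryLogChart (Fin N)))
    {X : (specialUnitaryLogChart (Fin N)).lie} (hXr : ‖X‖ < r) (hX : W₀ * (isChartRep_specialUnitaryGroup (n := Fin N)).expChart X ∈ O) :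
    ∃ L : (specialUnitaryLogChart (Fin N)).lie →L[ℝ] Matrix (Fin N) (Fin N) ℂ,
      HasFDerivAt (fun Y : (specialUnitaryLogChart (Fin N)).lie =>
        (((isChartRep_specialUnitaryGroup (n := Fin N)).logChart ((Φ W₀)⁻¹ * Φ (W₀ * (isChartRep_specialUnitaryGroup (n := Fin N)).expChart Y)) :
          (specialUnitaryLogChart (Fin N)).lie) : Matrix (Fin N) (Fin N) ℂ)) L X := by
  have hVu : ∀ i, (V i : Matrix (Fin N) (Fin N) ℂ) ∈ Matrix.unitaryGroup (Fin N) ℂ := fun i => (Matrix.mem_specialUnitaryGroup_iff.mp (V i).2).1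
  have hW₀u : (W₀ : Matrix (Fin N) (Fin N) ℂ) ∈ Matrix.unitaryGroup (Fin N) ℂ := (Matrix.mem_specialUnitaryGroup_iff.mp W₀.2).1
  -- the ambient derivative at `e^X`
  have hK := hasFDerivAt_ambient V c W₀ O hO hX
  -- the chain in the chart algebra
  have hchain := hK.comp X (hasFDerivAt_coe_exp (lie_adStable_specialUnitaryGroup (n := Fin N)) X)
  -- the log at `P = (Kmat W₀)*·Kmat(W₀e^X)`
  have h2B : 2 * B * ‖X‖ < 2 * B * r := mul_lt_mul_of_pos_left hXr (by positivity)
  have hP : ‖star (Kmat (fun i => (V i : Matrix (Fin N) (Fin N) ℂ)) c (W₀ : Matrix (Fin N) (Fin N) ℂ)) *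
        Kmat (fun i => (V i : Matrix (Fin N) (Fin N) ℂ)) c ((W₀ : Matrix (Fin N) (Fin N) ℂ) * exp (X : Matrix (Fin N) (Fin N) ℂ)) - 1‖ < 1 := by
    rw [← coe_conj_eq V c W₀ Φ O hΦ hW₀ hX]
    exact lt_of_le_of_lt (norm_conj_sub_one_le V c W₀ Φ O hO hΦ hW₀ hB0 hB hr2 hre hXr hX)
      ((h2B.trans_le hrB).trans_le (IsChartRep.innerRadius_le_half.trans (by norm_num)))
  have hmlog := ((MatrixLog.analyticAt_mlog hP).differentiableAt.hasFDerivAt.restrictScalars ℝ).comp X hchain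
  -- near `X` the conjugate IS `log P(Y)`
  refine ⟨_, hmlog.congr_of_eventuallyEq ?_⟩
  filter_upwards [(isOpen_windowSet W₀ O hOo r).mem_nhds ⟨hXr, hX⟩] with Y hY
  have h2BY : 2 * B * ‖Y‖ < 2 * B * r := mul_lt_mul_of_pos_left hY.1 (by positivity)
  have hltY : ‖fundamentalRep (Fin N) ((Φ W₀)⁻¹ * Φ (W₀ * (isChartRep_specialUnitaryGroup (n := Fin N)).expChart Y)) - 1‖ <
      innerRadius (specialUnitaryLogChart (Fin N)) := by
    rw [fundamentalRep_apply]
    exact lt_of_le_of_lt (norm_conj_sub_one_le V c W₀ Φ O hO hΦ hW₀ hB0 hB hr2 hre hY.1 hY.2) (h2BY.trans_le hrB)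
  simp only [Function.comp_apply]
  rw [(isChartRep_specialUnitaryGroup (n := Fin N)).coe_logChart hltY, fundamentalRep_apply, coe_conj_eq V c W₀ Φ O hΦ hW₀ hY.2]

include hO hΦ hW₀ in
/-- ★★ **THE CONJUGATE IS DIFFERENTIABLE ON THE WINDOW** as a map of the chart algebra (its matrix derivative takes values in the CLOSED subspace `𝔰𝔲(N)` —
`Literature.Analysis.Calculus.ContDiffCodRestrict.mem_of_hasFDerivAt_of_isClosed` ∕ `hasFDerivAt_codRestrict`). [folklore] -/
theorem differentiableAt_conj (hOo : IsOpen O) {B : ℝ} (hB0 : 0 < B)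
    (hB : ∀ (h : ι → Matrix (Fin N) (Fin N) ℂ) (W : Matrix (Fin N) (Fin N) ℂ), (∀ i, h i ∈ Matrix.unitaryGroup (Fin N) ℂ) →
      W ∈ Matrix.unitaryGroup (Fin N) ℂ → (∀ i, ‖h i * star W - 1‖ ≤ 1 / 2) → ‖emlD h c W‖ ≤ B)
    {r : ℝ} (hr2 : r ≤ 1 / 2) (hre : ∀ Z : Matrix (Fin N) (Fin N) ℂ, ‖Z‖ < r → ‖exp Z - 1‖ < 1 / 6)
    (hrB : 2 * B * r ≤ innerRadius (specialUnitaryLogChart (Fin N)))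
    {X : (specialUnitaryLogChart (Fin N)).lie} (hXr : ‖X‖ < r) (hX : W₀ * (isChartRep_specialUnitaryGroup (n := Fin N)).expChart X ∈ O) :
    DifferentiableAt ℝ (fun Y : (specialUnitaryLogChart (Fin N)).lie =>
        (isChartRep_specialUnitaryGroup (n := Fin N)).logChart ((Φ W₀)⁻¹ * Φ (W₀ * (isChartRep_specialUnitaryGroup (n := Fin N)).expChart Y))) X := by
  obtain ⟨L, hd⟩ := hasFDerivAt_coe_conj V c W₀ Φ O hO hΦ hW₀ hOo hB0 hB hr2 hre hrB hXr hX
  have hclosed : IsClosed ((specialUnitaryLogChart (Fin N)).lie : Set (Matrix (Fin N) (Fin N) ℂ)) :=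
    Submodule.closed_of_finiteDimensional _
  have hmem := Literature.Analysis.Calculus.mem_of_hasFDerivAt_of_isClosed (specialUnitaryLogChart (Fin N)).lie hclosed hd
    (Eventually.of_forall fun Y => Submodule.coe_mem _)
  exact (Literature.Analysis.Calculus.hasFDerivAt_codRestrict (specialUnitaryLogChart (Fin N)).lie (fun Y => Submodule.coe_mem _) hmem hd).differentiableAt



include hO hΦ hW₀ in
/-- ★★★ **THE HAAR-JACOBIAN PINCH OF THE CORE MAP ON THE WINDOW**: for `X` in the window (`O` open, radii as above, `det jac(X) ≠ 0`), weights `cᵢ ≥ 0` with `Σcᵢ ≤ 1`: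
`(1 − Σcᵢ)^{N²−1} ≤ J_Ψ(Θ X) ≤ 1`, `J_Ψ(Θ X) = |det jac(ψ X)|·|det ψ′(X)|∕|det jac(X)|` with `ψ′ = fderiv ψ` — INTENT-1's `jacobian_eq_abs_det_leftTangent` (`J = |det T|`) and §1's
`abs_det_pinch_lie` at the guarded point `W = W₀e^X`. [cite: Helgason2000, Ch. I §1 Thm. 1.14 (12) p. 96] [cite: Balaban1987RG1, (0.4) p.253 (the printed operation; bookkeeping)] -/
theorem jacobian_pinch (hOo : IsOpen O) {B : ℝ} (hB0 : 0 < B)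
    (hB : ∀ (h : ι → Matrix (Fin N) (Fin N) ℂ) (W : Matrix (Fin N) (Fin N) ℂ), (∀ i, h i ∈ Matrix.unitaryGroup (Fin N) ℂ) →
      W ∈ Matrix.unitaryGroup (Fin N) ℂ → (∀ i, ‖h i * star W - 1‖ ≤ 1 / 2) → ‖emlD h c W‖ ≤ B)
    {r : ℝ} (hr2 : r ≤ 1 / 2) (hre : ∀ Z : Matrix (Fin N) (Fin N) ℂ, ‖Z‖ < r → ‖exp Z - 1‖ < 1 / 6)
    (hrB : 2 * B * r ≤ innerRadius (specialUnitaryLogChart (Fin N))) (hc0 : ∀ i, 0 ≤ c i) (hc1 : ∑ i, c i ≤ 1)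
    {X : (specialUnitaryLogChart (Fin N)).lie} (hXr : ‖X‖ < r) (hX : W₀ * (isChartRep_specialUnitaryGroup (n := Fin N)).expChart X ∈ O)
    (hjacX : LinearMap.det (jac (lie_adStable_specialUnitaryGroup (n := Fin N)) X :
      (specialUnitaryLogChart (Fin N)).lie →ₗ[ℝ] (specialUnitaryLogChart (Fin N)).lie) ≠ 0) :
    ENNReal.ofReal ((1 - ∑ i, c i) ^ (N ^ 2 - 1)) ≤
      jacDensity (lie_adStable_specialUnitaryGroup (n := Fin N))
          ((isChartRep_specialUnitaryGroup (n := Fin N)).logChart ((Φ W₀)⁻¹ * Φ (W₀ * (isChartRep_specialUnitaryGroup (n := Fin N)).expChart X))) *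
        ENNReal.ofReal |(fderiv ℝ (fun Y : (specialUnitaryLogChart (Fin N)).lie =>
          (isChartRep_specialUnitaryGroup (n := Fin N)).logChart ((Φ W₀)⁻¹ * Φ (W₀ * (isChartRep_specialUnitaryGroup (n := Fin N)).expChart Y))) X).det| /
        jacDensity (lie_adStable_specialUnitaryGroup (n := Fin N)) X ∧
      jacDensity (lie_adStable_specialUnitaryGroup (n := Fin N))
          ((isChartRep_specialUnitaryGroup (n := Fin N)).logChart ((Φ W₀)⁻¹ * Φ (W₀ * (isChartRep_specialUnitaryGroup (n := Fin N)).expChart X))) *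
        ENNReal.ofReal |(fderiv ℝ (fun Y : (specialUnitaryLogChart (Fin N)).lie =>
          (isChartRep_specialUnitaryGroup (n := Fin N)).logChart ((Φ W₀)⁻¹ * Φ (W₀ * (isChartRep_specialUnitaryGroup (n := Fin N)).expChart Y))) X).det| /
        jacDensity (lie_adStable_specialUnitaryGroup (n := Fin N)) X ≤ 1 := by
  have hVu : ∀ i, (V i : Matrix (Fin N) (Fin N) ℂ) ∈ Matrix.unitaryGroup (Fin N) ℂ := fun i => (Matrix.mem_specialUnitaryGroup_iff.mp (V i).2).1
  have hW₀u : (W₀ : Matrix (Fin N) (Fin N) ℂ) ∈ Matrix.unitaryGroup (Fin N) ℂ := (Matrix.mem_specialUnitaryGroup_iff.mp W₀.2).1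
  have hΩo := isOpen_windowSet W₀ O hOo r
  have hXΩ : X ∈ {Y : (specialUnitaryLogChart (Fin N)).lie | ‖Y‖ < r ∧ W₀ * (isChartRep_specialUnitaryGroup (n := Fin N)).expChart Y ∈ O} := ⟨hXr, hX⟩
  have hψ' := (differentiableAt_conj V c W₀ Φ O hO hΦ hW₀ hOo hB0 hB hr2 hre hrB hXr hX).hasFDerivAt.hasFDerivWithinAt
    (s := {Y : (specialUnitaryLogChart (Fin N)).lie | ‖Y‖ < r ∧ W₀ * (isChartRep_specialUnitaryGroup (n := Fin N)).expChart Y ∈ O})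
  have hΨ : ∀ Y ∈ {Y : (specialUnitaryLogChart (Fin N)).lie | ‖Y‖ < r ∧ W₀ * (isChartRep_specialUnitaryGroup (n := Fin N)).expChart Y ∈ O},
      (fun g => (Φ W₀)⁻¹ * Φ (W₀ * g)) ((isChartRep_specialUnitaryGroup (n := Fin N)).expChart Y) =
        (isChartRep_specialUnitaryGroup (n := Fin N)).expChart
          ((isChartRep_specialUnitaryGroup (n := Fin N)).logChart ((Φ W₀)⁻¹ * Φ (W₀ * (isChartRep_specialUnitaryGroup (n := Fin N)).expChart Y))) :=
    fun Y hY => semiconj V c W₀ Φ O hO hΦ hW₀ hB0 hB hr2 hre hrB hY.1 hY.2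
  have hK := hasFDerivAt_ambient V c W₀ O hO hX
  have hKρ : ∀ Y ∈ {Y : (specialUnitaryLogChart (Fin N)).lie | ‖Y‖ < r ∧ W₀ * (isChartRep_specialUnitaryGroup (n := Fin N)).expChart Y ∈ O},
      (fun M : Matrix (Fin N) (Fin N) ℂ => star (Kmat (fun i => (V i : Matrix (Fin N) (Fin N) ℂ)) c (W₀ : Matrix (Fin N) (Fin N) ℂ)) *
          Kmat (fun i => (V i : Matrix (Fin N) (Fin N) ℂ)) c ((W₀ : Matrix (Fin N) (Fin N) ℂ) * M)) (exp ((Y : (specialUnitaryLogChart (Fin N)).lie) : Matrix (Fin N) (Fin N) ℂ)) =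
        fundamentalRep (Fin N) ((fun g => (Φ W₀)⁻¹ * Φ (W₀ * g)) ((isChartRep_specialUnitaryGroup (n := Fin N)).expChart Y)) := fun Y hY => by
    simp only [fundamentalRep_apply]
    exact (coe_conj_eq V c W₀ Φ O hΦ hW₀ hY.2).symm
  -- the left-trivialised tangent map at the guarded point `W = W₀·Θ X`
  obtain ⟨T, hT0⟩ := exists_leftTangent_lie V (W₀ * (isChartRep_specialUnitaryGroup (n := Fin N)).expChart X) (hO _ hX) c
  have hpinch := abs_det_pinch_lie V (W₀ * (isChartRep_specialUnitaryGroup (n := Fin N)).expChart X) (hO _ hX) hc0 hc1 T hT0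
  have hK₀ : Kmat (fun i => (V i : Matrix (Fin N) (Fin N) ℂ)) c (W₀ : Matrix (Fin N) (Fin N) ℂ) *
      star (Kmat (fun i => (V i : Matrix (Fin N) (Fin N) ℂ)) c (W₀ : Matrix (Fin N) (Fin N) ℂ)) = 1 :=
    Matrix.mem_unitaryGroup_iff.mp (kmat_mem_unitaryGroup hVu hW₀u (guard_half_of_deltaSU (hO W₀ hW₀)) c)
  have hexp : exp ((((isChartRep_specialUnitaryGroup (n := Fin N)).logChart
        ((Φ W₀)⁻¹ * Φ (W₀ * (isChartRep_specialUnitaryGroup (n := Fin N)).expChart X))) : (specialUnitaryLogChart (Fin N)).lie) : Matrix (Fin N) (Fin N) ℂ) =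
      star (Kmat (fun i => (V i : Matrix (Fin N) (Fin N) ℂ)) c (W₀ : Matrix (Fin N) (Fin N) ℂ)) *
        Kmat (fun i => (V i : Matrix (Fin N) (Fin N) ℂ)) c ((W₀ : Matrix (Fin N) (Fin N) ℂ) * exp (X : Matrix (Fin N) (Fin N) ℂ)) := by
    rw [← coe_expChart, ← semiconj V c W₀ Φ O hO hΦ hW₀ hB0 hB hr2 hre hrB hXr hX, coe_conj_eq V c W₀ Φ O hΦ hW₀ hX]
  have hU : star (Kmat (fun i => (V i : Matrix (Fin N) (Fin N) ℂ)) c (W₀ : Matrix (Fin N) (Fin N) ℂ)) *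
      Kmat (fun i => (V i : Matrix (Fin N) (Fin N) ℂ)) c ((W₀ : Matrix (Fin N) (Fin N) ℂ) * exp (X : Matrix (Fin N) (Fin N) ℂ)) ∈ Matrix.unitaryGroup (Fin N) ℂ := by
    rw [← coe_conj_eq V c W₀ Φ O hΦ hW₀ hX]
    exact (Matrix.mem_specialUnitaryGroup_iff.mp ((Φ W₀)⁻¹ * Φ (W₀ * (isChartRep_specialUnitaryGroup (n := Fin N)).expChart X)).2).1
  have hT : ∀ v : (specialUnitaryLogChart (Fin N)).lie, ((T v : (specialUnitaryLogChart (Fin N)).lie) : Matrix (Fin N) (Fin N) ℂ) =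
      exp (-((((isChartRep_specialUnitaryGroup (n := Fin N)).logChart
        ((Φ W₀)⁻¹ * Φ (W₀ * (isChartRep_specialUnitaryGroup (n := Fin N)).expChart X))) : (specialUnitaryLogChart (Fin N)).lie) : Matrix (Fin N) (Fin N) ℂ)) *
        ((ContinuousLinearMap.mul ℝ (Matrix (Fin N) (Fin N) ℂ) (star (Kmat (fun i => (V i : Matrix (Fin N) (Fin N) ℂ)) c (W₀ : Matrix (Fin N) (Fin N) ℂ)))).comp
          ((emlD (fun i => (V i : Matrix (Fin N) (Fin N) ℂ)) c ((W₀ : Matrix (Fin N) (Fin N) ℂ) * exp (X : Matrix (Fin N) (Fin N) ℂ))).comp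
            (ContinuousLinearMap.mul ℝ (Matrix (Fin N) (Fin N) ℂ) (W₀ : Matrix (Fin N) (Fin N) ℂ))))
          (exp ((X : (specialUnitaryLogChart (Fin N)).lie) : Matrix (Fin N) (Fin N) ℂ) * (v : Matrix (Fin N) (Fin N) ℂ)) := by
    intro v
    rw [hT0 v, exp_neg_eq_star hU hexp, coe_mul_expChart]
    simp only [ContinuousLinearMap.comp_apply, ContinuousLinearMap.mul_apply', star_mul, star_star]
    rw [mul_assoc (W₀ : Matrix (Fin N) (Fin N) ℂ) (exp (X : Matrix (Fin N) (Fin N) ℂ)) (v : Matrix (Fin N) (Fin N) ℂ),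
      ← mul_assoc (star (Kmat (fun i => (V i : Matrix (Fin N) (Fin N) ℂ)) c ((W₀ : Matrix (Fin N) (Fin N) ℂ) * exp (X : Matrix (Fin N) (Fin N) ℂ))) *
        Kmat (fun i => (V i : Matrix (Fin N) (Fin N) ℂ)) c (W₀ : Matrix (Fin N) (Fin N) ℂ)),
      mul_assoc (star (Kmat (fun i => (V i : Matrix (Fin N) (Fin N) ℂ)) c ((W₀ : Matrix (Fin N) (Fin N) ℂ) * exp (X : Matrix (Fin N) (Fin N) ℂ)))),
      hK₀, mul_one]
  have hJ := jacobian_eq_abs_det_leftTangent (isChartRep_specialUnitaryGroup (n := Fin N)) (lie_adStable_specialUnitaryGroup (n := Fin N))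
    (Ψ := fun g => (Φ W₀)⁻¹ * Φ (W₀ * g))
    (K := fun M : Matrix (Fin N) (Fin N) ℂ => star (Kmat (fun i => (V i : Matrix (Fin N) (Fin N) ℂ)) c (W₀ : Matrix (Fin N) (Fin N) ℂ)) *
      Kmat (fun i => (V i : Matrix (Fin N) (Fin N) ℂ)) c ((W₀ : Matrix (Fin N) (Fin N) ℂ) * M))
    hΩo hXΩ hψ' hΨ hK hKρ hT hjacX
  rw [hJ]
  exact ⟨ENNReal.ofReal_le_ofReal hpinch.1, by rw [← ENNReal.ofReal_one]; exact ENNReal.ofReal_le_ofReal hpinch.2⟩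

include hO hΦ hW₀ in
/-- ★★★ **THE HAAR-JACOBIAN FLOOR** `(1 − Σcᵢ)^{N²−1} ≤ J_Ψ(Θ X)` on the window (`jacobian_pinch`, first half — the `hm` socket of INTENT-1's frame). [folklore] -/
theorem jacobian_ge (hOo : IsOpen O) {B : ℝ} (hB0 : 0 < B)
    (hB : ∀ (h : ι → Matrix (Fin N) (Fin N) ℂ) (W : Matrix (Fin N) (Fin N) ℂ), (∀ i, h i ∈ Matrix.unitaryGroup (Fin N) ℂ) →
      W ∈ Matrix.unitaryGroup (Fin N) ℂ → (∀ i, ‖h i * star W - 1‖ ≤ 1 / 2) → ‖emlD h c W‖ ≤ B)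
    {r : ℝ} (hr2 : r ≤ 1 / 2) (hre : ∀ Z : Matrix (Fin N) (Fin N) ℂ, ‖Z‖ < r → ‖exp Z - 1‖ < 1 / 6)
    (hrB : 2 * B * r ≤ innerRadius (specialUnitaryLogChart (Fin N))) (hc0 : ∀ i, 0 ≤ c i) (hc1 : ∑ i, c i ≤ 1)
    {X : (specialUnitaryLogChart (Fin N)).lie} (hXr : ‖X‖ < r) (hX : W₀ * (isChartRep_specialUnitaryGroup (n := Fin N)).expChart X ∈ O)
    (hjacX : LinearMap.det (jac (lie_adStable_specialUnitaryGroup (n := Fin N)) X :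
      (specialUnitaryLogChart (Fin N)).lie →ₗ[ℝ] (specialUnitaryLogChart (Fin N)).lie) ≠ 0) :
    ENNReal.ofReal ((1 - ∑ i, c i) ^ (N ^ 2 - 1)) ≤
      jacDensity (lie_adStable_specialUnitaryGroup (n := Fin N))
          ((isChartRep_specialUnitaryGroup (n := Fin N)).logChart ((Φ W₀)⁻¹ * Φ (W₀ * (isChartRep_specialUnitaryGroup (n := Fin N)).expChart X))) *
        ENNReal.ofReal |(fderiv ℝ (fun Y : (specialUnitaryLogChart (Fin N)).lie =>
          (isChartRep_specialUnitaryGroup (n := Fin N)).logChart ((Φ W₀)⁻¹ * Φ (W₀ * (isChartRep_specialUnitaryGroup (n := Fin N)).expChart Y))) X).det| /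
        jacDensity (lie_adStable_specialUnitaryGroup (n := Fin N)) X :=
  (jacobian_pinch V c W₀ Φ O hO hΦ hW₀ hOo hB0 hB hr2 hre hrB hc0 hc1 hXr hX hjacX).1


end Conjugate

end Summit.QuantumFields.YangMills.BalabanUVNodes.N08HaarCompatibilityGuardCoreChartConjugateSUN

end
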